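import Summits.BirchSwinnertonDyer.Rank1Residual.X9.PrintX9LeafDoorOfAnyClassNumber
import Summits.BirchSwinnertonDyer.BirchSwinnertonDyer.Theses.PrintX9
import HarnessLib

/-!
# `PrintX9.AssemblyLightFramePinned` (stmt-BirchSwinnertonDyer-26361, route PrintX9 rev 22, gate
# auto-crux r1 — the PINNED light assembly) BY NAME: turnkey T-F of plan g9

`AssemblyLightFramePinned : HowardContainmentLightFramePinned → TwoSidedLinkPinned → MuTransfer →
AnalyticMuZeroX9 → HeegnerPrintFactsX9 → CyclotomicPrintFactsX9 → BSDpOnClassX9` — ty3's T-E assembly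
(`Rank1Residual/X9/PrintX9LeafDoorOfLightFrame.lean`, `TorsionLayer.assemblyLightFrame_holds`, p596936,
REF-99 (C)) re-run VERBATIM for the PIN-1 repair (plan g9 FINDING PIN-1 / REF-104): ONE changed line —
`hc : ¬ (p : ℤ) ∣ Dt.c` (Mazur's Manin-constant pin, already produced by `X11b.exists_maninDatum_of_good`) is
passed to the pinned crux `A^pin = HowardContainmentLightFramePinned`, whose tied conclusion
`∃ jbar D F X, F.Dt = Dt ∧ I(ℋ_F)² ⊆ char(X_tors)` is exactly the hypothesis of the pinned B-door
`TwoSidedLinkPinned`. Source: the planner's certified turnkey HOME/plan/turnkeys/T-F-AssemblyLightFramePinned.lean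
(rc 0 with local copies of the rev-20 texts; here the local `PrintX9Rev20Local` definitions are swapped for the
landed route decls of `Theses.PrintX9` rev 22, bodies identical). Landed by seat x9-p1-w2 as the idle prover the
planner asked for (PROGRESS 3 (b)). Glue only; «beyond-print theorem»: no. The item is the gate's composition
crux (r1); closing it does NOT close the deciding crux 26359 (`HowardContainmentLightFramePinnedOfPrint`, beyond
print) — no leaf moves; BSD is not proved by any of this.
-/

set_option linter.dupNamespace false
set_option autoImplicit false

noncomputable section

open scoped Classical MatrixGroups ModularForm

open CongruenceSubgroup WeierstrassCurve NumberField IsDedekindDomain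
  Literature.NumberTheory.EllipticCurves Literature.NumberTheory.EllipticCurves.ModularForms
  Literature.NumberTheory.EllipticCurves.BurungaleCastellaSkinner2025
  Literature.NumberTheory.EllipticCurves.JetchevSkinnerWan2017
  Literature.NumberTheory.EllipticCurves.YanZhu2026
  Summit.BirchSwinnertonDyer.BirchSwinnertonDyer.Theorems.Rank1ResidualX1Defs
  Summit.BirchSwinnertonDyer.Rank1Residual

open Literature.NumberTheory.EllipticCurves.Rank1Residual (GoodOrd Irr Surj BigIm
  norm_periodRatio_eq_one pPart_of_bsdp not_dvd_discr_of_split)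

open Summit.BirchSwinnertonDyer.BirchSwinnertonDyer.Theses
open Summit.BirchSwinnertonDyer.BirchSwinnertonDyer.Theses.PrintX9

namespace Summit.BirchSwinnertonDyer.BirchSwinnertonDyer.Rank1Residual

namespace TorsionLayerPinned

/-- §1-pinned: the index identity at a light X9 Heegner frame from the PINNED cruxes `A^pin`, `B^pin` (T-E §1
with `hc : ¬ p ∣ Dt.c` passed to `A^pin`). [cite: JetchevSkinnerWan2017, Thm. 3.3.1 (anticyclotomic control)]
[cite: GrossZagier1986, Thm. I.6.3] [cite: Kolyvagin1990, Thm. A] -/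
theorem indexIdentityAt_of_lightCruxes
    (hA : HowardContainmentLightFramePinned) (hB : TwoSidedLinkPinned)
    (h331 : thm331_anticyclotomicControl)
    (hmod : hasEntireLFunction_rat) (hGZK : rank_eq_analyticRank_of_analyticRank_le_one)
    (W : WeierstrassCurve ℚ) [W.IsElliptic] [W.IsGloballyMinimal] (p : ℕ) [Fact p.Prime]
    (K : Type) [Field K] [NumberField K] [NeZero (W.conductorNorm ℤ)]
    (Dt : ModularParametrizationData W (W.conductorNorm ℤ))
    (H : HeegnerDatum (W.conductorNorm ℤ) (NumberField.discr K)) (ιC : K →+* ℂ)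
    (P : (W.baseChange K).toAffine.Point)
    (hGZ : gross_zagier (W.conductorNorm ℤ) W K) (hKo : kolyvagin (W.conductorNorm ℤ) W K)
    (hX9 : ClassX9 W p) (hr : W.analyticRank = 1)
    (hK : IsImaginaryQuadratic K) (hodd : Odd (NumberField.discr K)) (hlt : NumberField.discr K < -4)
    (hHN : SatisfiesHeegnerHypothesis (W.conductorNorm ℤ) K) (hHp : SatisfiesHeegnerHypothesis p K)
    (hLt : (W.quadraticTwist (NumberField.discr K : ℚ)).entireLFunction 1 ≠ 0)
    (hP : WeierstrassCurve.Affine.Point.map ιC.toRatAlgHom P = heegnerPointComplex Dt H)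
    (hc : ¬ (p : ℤ) ∣ Dt.c) : X11b.IndexIdentityAt W p K P := by
  have hX9' := classX9_census_of_classX9 W p hX9
  have hpP : p.Prime := Fact.out
  have hp5 : 5 ≤ p := hX9'.five_le
  have hp2 : p ≠ 2 := hX9'.ne_two
  have h3 : NumberField.discr K ≠ -3 := by omega
  have h4 : NumberField.discr K ≠ -4 := by omega
  haveI : Finite (W.baseChange K).sha :=
    X11b.finite_sha_baseChange_of_heegner W (W.conductorNorm ℤ) K Dt H ιC P hGZ hKo hmod hr hK hHN hLt hP
  obtain ⟨hrQ, hShaQ⟩ := hGZK W hr.le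
  rw [hr] at hrQ
  obtain ⟨hrk, hfinp⟩ :=
    mordellWeilRank_baseChange_eq_one_and_finite_sha_of_twist_L_one_ne_zero hGZK W K hK p hrQ hShaQ
      hLt
  have hPinf : ¬ IsOfFinAddOrder P :=
    X11b.not_isOfFinAddOrder_of_heegner_of_analyticRank_eq_one W (W.conductorNorm ℤ) K Dt H ιC P hGZ
      hmod hr hK hHN hLt hP
  have hirrK : (W.baseChange K).HasIrreducibleModPGaloisRep p :=
    MatarNekovar2019.prop526_hasIrreducibleModPGaloisRep_baseChange_holds W K hK.1
      (Literature.SatisfiesHeegnerHypothesis.coprime_discr hK.1 hHN) p hp2 hX9'.irr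
  obtain ⟨κ, γ, 𝔭, hκ, hγ, h𝔭⟩ := X11b.exists_anticyclotomic_generator_prime (p := p) hK
  haveI : Fact (κ.IsTopGenerator γ) := ⟨hγ⟩
  have hsplit : X11b.SplitsIn K p := hHp p Fact.out (dvd_refl p)
  obtain ⟨he, hf⟩ := X11b.degreeOne_of_splitsIn hK.1 hsplit h𝔭
  set ι : K →+* ℚ_[p] := X11b.embAt K p 𝔭 h𝔭 he hf with hι
  have hCTL : X11b.ControlOnTreeGoodAt p κ (X11b.inducedPlace ι) γ ι P :=
    X11b.controlOnTreeGoodAt_of_thm331_of_inducedPlace h331 (by omega) hX9'.good hK hHp rfl hHN hirrK ι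
      κ hκ γ hrk hfinp P hPinf
  -- THE ONE CHANGED LINE: crux A is consumed at the light frame only
  have hHow := hA W p K hX9 hK hodd h3 hHN hHp hirrK κ hκ γ hγ Dt H ιC hc hrk hfinp  -- PIN-1: `hc` passed to A^pin
  have hIW : X11b.IMCWaldspurgerOnTreeGoodAt p κ (X11b.inducedPlace ι) γ ι P :=
    hB W p K hX9 hK hodd h3 hHN hHp hirrK ι κ hκ γ Dt hc H ιC P hP hrk hfinp hPinf hHow
  exact X11b.indexIdentityAt_of_onTreeGoodLinks_of_allSplit hK rfl hHN hIW hCTL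

/-- §2-pinned: `BSD_p` in analytic rank one at an X9 pair on a light frame, from the pinned cruxes (T-E §2
verbatim; the Manin datum of `X11b.exists_maninDatum_of_good` supplies `hc`). [cite: GrossZagier1986, Thm. I.6.3]
[cite: Kolyvagin1990, Thm. A] [cite: Mazur1978, Cor. 4.1 (p ∤ c for p odd of good reduction)] -/
theorem bsdp_rankOne_of_lightFrame_of_lightCruxes
    (hA : HowardContainmentLightFramePinned) (hB : TwoSidedLinkPinned)
    (h331 : thm331_anticyclotomicControl)
    (hGZ : ∀ (N : ℕ) [NeZero N] (W : WeierstrassCurve ℚ) (K : Type) [Field K] [NumberField K],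
      gross_zagier N W K)
    (hKo : ∀ (N : ℕ) [NeZero N] (W : WeierstrassCurve ℚ) (K : Type) [Field K] [NumberField K],
      kolyvagin N W K)
    (hGr : greenberg_charValue_rankZero) (hGZK : rank_eq_analyticRank_of_analyticRank_le_one)
    (hmod : hasEntireLFunction_rat) (hpar : nonempty_modularParametrizationData)
    (hnf : exists_isNewformOf)
    (hMaz : mazur_not_dvd_maninConstant_of_odd) (hNS : integral_neronScaling_of_isGloballyMinimal)
    (h5 : realPeriodRat_eq_unit_mul_plusPeriod)
    (W : WeierstrassCurve ℚ) [W.IsElliptic] [W.IsGloballyMinimal] (p : ℕ) [Fact p.Prime]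
    (hX9 : ClassX9 W p) (hr : W.analyticRank = 1)
    (K : Type) [Field K] [NumberField K] (hK : IsImaginaryQuadratic K)
    (hodd : Odd (NumberField.discr K)) (hlt : NumberField.discr K < -4)
    (hHN : SatisfiesHeegnerHypothesis (W.conductorNorm ℤ) K) (hHp : SatisfiesHeegnerHypothesis p K)
    (hLt : (W.quadraticTwist (NumberField.discr K : ℚ)).entireLFunction 1 ≠ 0)
    (hIMC : IntegralMainConjectureOnClassX9) : BSDp W p := by
  obtain ⟨-, hp5, hgood, hord, hirr, -⟩ := id hX9
  have hpP : p.Prime := Fact.out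
  have hp2 : p ≠ 2 := by omega
  haveI : NeZero (W.conductorNorm ℤ) := ⟨(W.conductorNorm_pos_holds).ne'⟩
  have hpd : ¬ (p : ℤ) ∣ NumberField.discr K := not_dvd_discr_of_split hK hpP hp2 hHp
  have hμ : ¬ p ∣ Units.torsionOrder K := by
    haveI : IsTotallyComplex K := hK.2
    rw [Literature.NumberTheory.DiophantineGeometry.torsionOrder_eq_two_of_discr_lt hK.1 hlt]
    intro hdvd
    have := Nat.le_of_dvd two_pos hdvd
    omega
  obtain ⟨Dt, H, ι, P, hP, hc⟩ :=
    X11b.exists_maninDatum_of_good hnf hMaz hNS W p (W.conductorNorm ℤ) K rfl hp2 hgood hirr hK hHN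
  have hid : Finite (W.baseChange K).sha → X11b.IndexIdentityAt W p K P := fun _ ↦
    indexIdentityAt_of_lightCruxes hA hB h331 hmod hGZK W p K Dt H ι P (hGZ _ W K) (hKo _ W K) hX9 hr
      hK hodd hlt hHN hHp hLt hP hc
  have hD0 : (NumberField.discr K : ℚ) ≠ 0 := by exact_mod_cast NumberField.discr_ne_zero K
  haveI hEt : (W.quadraticTwist (NumberField.discr K : ℚ)).IsElliptic :=
    W.isElliptic_quadraticTwist hD0
  obtain ⟨Cd, hCd⟩ := hasGlobalMinimalModel_rat_holds (W.quadraticTwist (NumberField.discr K : ℚ))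
  haveI : (Cd • W.quadraticTwist (NumberField.discr K : ℚ)).IsGloballyMinimal := hCd
  have hWd : Cd • W.quadraticTwist (NumberField.discr K : ℚ) =
      Cd • W.quadraticTwist (NumberField.discr K : ℚ) := rfl
  have hX9d : ClassX9 (Cd • W.quadraticTwist (NumberField.discr K : ℚ)) p :=
    classX9_twist_model hX9 K hK.1 hpd Cd hWd
  have hordd : GoodOrd (Cd • W.quadraticTwist (NumberField.discr K : ℚ)) p :=
    ⟨hX9d.2.2.1, hX9d.2.2.2.1⟩
  have htam : padicValNat p (Cd • W.quadraticTwist (NumberField.discr K : ℚ)).tamagawaProduct =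
      padicValNat p W.tamagawaProduct :=
    X2.padicValNat_tamagawaProduct_twist_of_heegner_of_odd W p hp2 K hK hodd hpd hHN Cd hWd
  have hu : padicValRat p (Cd.u : ℚ) = 0 :=
    X11b.padicValRat_u_eq_zero_of_twist_good W p hpd hgood Cd hWd hordd.1
  have hMCd : MazurMainConjecture (Cd • W.quadraticTwist (NumberField.discr K : ℚ)) p :=
    mazurMainConjecture_of_integralMainConjectureOnClassX9 h5 hIMC hX9d
  exact X11b.bsdp_rankOne_of_indexIdentityAt_of_twist_mazurMainConjecture W p (W.conductorNorm ℤ) K Dt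
    H ι P (hGZ _ W K) (hKo _ W K) hGr hGZK hmod hpar hr hp2 hK hHN hP hc hμ hLt
    (Cd • W.quadraticTwist (NumberField.discr K : ℚ)) Cd hWd hordd htam hu hMCd hid

/-- §3-pinned: PrintX9's leaf `BSDpOnClassX9` from the PINNED cruxes, the `μ`-inputs and the two print
bundles (T-E §3 verbatim). [cite: GrossZagier1986, Thm. I.6.3] [cite: Kolyvagin1990, Thm. A]
[cite: JetchevSkinnerWan2017, Thm. 3.3.1] -/
theorem bsdpOnClassX9_of_lightCruxes_of_muInputs_of_printFacts
    (hA : HowardContainmentLightFramePinned) (hB : TwoSidedLinkPinned)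
    (hT : PrintX9.MuTransfer) (hμ : PrintX9.AnalyticMuZeroX9)
    (hHP : PrintX9.HeegnerPrintFactsX9) (hCP : PrintX9.CyclotomicPrintFactsX9) :
    Summit.BirchSwinnertonDyer.BirchSwinnertonDyer.Rank1Residual.BSDpOnClassX9 := by
  obtain ⟨hGZ, hKo, -, -, -, -, -, h331, hnf, hHL, hMaz, hNS⟩ := hHP
  obtain ⟨hBCS, hGr, hGZK, hmod, hpar, h5⟩ := hCP
  have hF := TorsionLayer.lightFrameSupplyOdd_of_hoffsteinLuo hnf hHL
  have hE := integralMainConjectureOnClassX9_of_katoMuTransfer hBCS hT hμ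
  intro W _ _ p _ hran hX9 _
  obtain ⟨-, hp5, hgood, hord, -, -⟩ := id hX9
  have hbsdp : BSDp W p := by
    rcases Nat.lt_or_ge W.analyticRank 1 with h0 | h1
    · exact bsdp_of_mazurMainConjecture_of_analyticRank_eq_zero hGr hpar hGZK (by omega) ⟨hgood, hord⟩
        (by omega) (mazurMainConjecture_of_integralMainConjectureOnClassX9 h5 hE hX9)
    · have hr : W.analyticRank = 1 := le_antisymm hran h1
      haveI : NeZero (W.conductorNorm ℤ) := ⟨(W.conductorNorm_pos_holds).ne'⟩
      obtain ⟨K, _, _, hK, hodd, hlt, hHN, hHp, hLt⟩ := hF W p hX9 hr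
      exact bsdp_rankOne_of_lightFrame_of_lightCruxes hA hB h331 hGZ hKo hGr hGZK hmod hpar hnf hMaz hNS
        h5 W p hX9 hr K hK hodd hlt hHN hHp hLt hE
  exact (pPartBSD_iff_pPart W p).mpr (pPart_of_bsdp hmod hGZK W p hran hbsdp)

/-- **Item `PrintX9.AssemblyLightFramePinned` (stmt-BirchSwinnertonDyer-26361) holds** — the gate's closing
shape, BY NAME (turnkey T-F; T-E p596936 re-run with the Manin pin passed to `A^pin`).
[cite: GrossZagier1986, Thm. I.6.3] [cite: Kolyvagin1990, Thm. A] [cite: JetchevSkinnerWan2017, Thm. 3.3.1] -/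
theorem assemblyLightFramePinned_holds :
    Summit.BirchSwinnertonDyer.BirchSwinnertonDyer.Theses.PrintX9.AssemblyLightFramePinned := by
  unfold Summit.BirchSwinnertonDyer.BirchSwinnertonDyer.Theses.PrintX9.AssemblyLightFramePinned
  exact bsdpOnClassX9_of_lightCruxes_of_muInputs_of_printFacts

end TorsionLayerPinned

end Summit.BirchSwinnertonDyer.BirchSwinnertonDyer.Rank1Residual

end
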